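import Literature.AlgebraicGeometry.FundamentalGroup.RiemannExistenceCharPolyIntegral
import Literature.AlgebraicGeometry.Motives.RatFnBirationalHartogs
import Literature.AlgebraicGeometry.Motives.AbelianVarietyDegree
import Literature.AlgebraicGeometry.Resolution.FiniteBirationalNormal
import Literature.AlgebraicGeometry.Resolution.RegularLocalRingsNormal
import Mathlib.RingTheory.Polynomial.IntegralNormalization
import Mathlib.FieldTheory.IsAlgClosed.Basic
import HarnessLib

/-!
# Riemann's existence theorem: continuous rational functions on a smooth variety are regular

Topic `Literature/AlgebraicGeometry/FundamentalGroup`; proof file continuing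
`RiemannExistenceCharPolyRegular.lean` (continuous + integral ⇒ regular) and
`RiemannExistenceCharPolyIntegral.lean` (Theorem B). The integrality hypothesis of Theorem B is
relaxed to ALGEBRAICITY — any non-zero polynomial relation over the regular functions — which is
the form in which function-theoretic methods (GAGA, meromorphic functions on compactifications,
`L²`-methods) deliver functions on a finite covering:

* `ContinuousRational.exists_eval_eq_of_continuous_rational` — **a continuous rational function on
  a variety with regular (e.g. smooth) local rings is regular**: `X` integral and locally of finite
  type over `ℂ` with all local rings regular, `V ⊆ X` affine open, `a, b ∈ Γ(X, V)`, `a ≠ 0`, and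
  `g` continuous on `V(ℂ)` (strong topology) with `g(P) a(P) = b(P)` for all `P ∈ V(ℂ)`; then
  `g = c` on `V(ℂ)` for some `c ∈ Γ(X, V)`. Proof — algebraic Hartogs, as in the tree's
  `RatFn.isRegularAt_of_forall_isRegularAt_comap` (Görtz–Wedhorn I, Thm. 6.45): at a point `y` of
  codimension `≤ 1` the local ring is a discrete valuation ring, so if `b/a ∉ 𝒪_{X,y}` then
  `a/b ∈ 𝔪_y`, `a/b = a'/b'` with `a'(y) = 0 ≠ b'(y)`, and `g a' = b'` on `V(ℂ)` (it holds on the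
  dense `D(a)(ℂ)`), which is absurd at a complex point of `\overline{{y}} ∩ D(b')`
  (`isRegularAt_of_continuous_of_ringKrullDim_le_one`); at an arbitrary point the factorial local
  ring `𝒪_{X,y}` (Auslander–Buchsbaum) is the intersection of its localisations at prime elements,
  which are local rings of codimension-one points (`isRegularAt_of_continuous`); a rational function
  regular at all points of `V` is a section (`RatFn.exists_germ_eq_of_forall_isRegularAt`), equal to
  `g` on `D(a)(ℂ)` hence on `V(ℂ)` by density (SGA1 XII Prop. 2.2, `eqOn_of_eqOn_basicOpen`).
* `ContinuousRational.exists_charPoly_of_algebraic` — **Theorem B′.** For `q : T → X(ℂ)` a covering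
  map with finite fibres, `X` as above and separated, `U` affine open, `h : T → ℂ` continuous on
  `q⁻¹(U(ℂ))` and ALGEBRAIC over `Γ(X, U)` (`F(q t)(h t) = 0` for one `F ∈ Γ(X, U)[τ]`, `F ≠ 0`),
  the fibrewise characteristic polynomial of `h` is a monic REGULAR polynomial: with
  `a = lead(F)`, `a h` is integral (Mathlib `Polynomial.integralNormalization`), so Theorem B gives
  the characteristic polynomial `Q₁` of `a h`; the coefficients of `χ_h` are the continuous rational
  functions `coeff_j(Q₁) / a^{d-j}`, hence regular.
* `riemannExistence_qbarDescent_of_finiteIndex_of_algebraicSeparating`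
  (`RiemannExistenceQbarDescentProofs.lean`, sequel) — the `ℚ̄`-descent form of Riemann's existence
  theorem follows from the existence, on every finite covering of a smooth irreducible affine
  `S(ℂ)`, of continuous functions algebraic over `Γ(S, 𝒪_S)` separating one fibre.

## References

* [SGA1] A. Grothendieck, M. Raynaud, *SGA 1* (LNM 224 / arXiv:math/0206203), Exp. XII Prop. 2.2,
  Thm. 5.1 (p. 333) and its proof, part 2.
* U. Görtz, T. Wedhorn, *Algebraic Geometry I: Schemes*, 2nd ed. (2020), Thm. 6.45 (p. 203)
  (algebraic Hartogs), Prop. B.73 (3). [GortzWedhorn2020]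
* H. Matsumura, *Commutative Ring Theory*, CSAM 8 (1986), Thm. 11.5, Thm. 20.3. [Matsumura1987]
* O. Forster, *Lectures on Riemann Surfaces*, GTM 81 (1981), §8 (algebraic functions on finite
  coverings; the one-dimensional model). [Forster1981]

#harness_tags algebraic_geometry.etale, algebraic_geometry.sga1, complex_geometry.riemann_existence
-/

noncomputable section

universe u

open CategoryTheory AlgebraicGeometry Polynomial Ideal
open _root_.Topology

namespace Literature.AlgebraicGeometry.FundamentalGroup

open Literature.AlgebraicGeometry.Motives Literature.AlgebraicGeometry.Motives.AlgPoints
open Literature.AlgebraicGeometry.Motives.RatFn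
open Literature.RingTheory.UniqueFactorizationDomain

namespace ContinuousRational

/-! ### Density: functions agreeing on `D(s)(ℂ)` agree on `V(ℂ)` -/

section Density

variable {X : SchemeOver ℂ} [LocallyOfFiniteType X.hom] [IsIntegral X.left]

/-- **Two functions continuous on `V(ℂ)` that agree on `D(s)(ℂ)`, `s ∈ Γ(X, V)` non-zero, agree on
`V(ℂ)`**: `D(s)` is a dense open of the irreducible `X`, so `D(s)(ℂ)` is dense in `X(ℂ)` for the
strong topology (SGA1 XII Prop. 2.2, `ComplexPoints.dense_setOf_pt_mem`), and `ℂ` is Hausdorff.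
[cite: SGA1, Exp. XII Prop. 2.2] -/
theorem eqOn_of_eqOn_basicOpen {V : X.left.Opens} {s : Γ(X.left, V)} (hs : s ≠ 0)
    {f g : ComplexPoints X → ℂ} (hf : ContinuousOn f {P | P.pt ∈ V})
    (hg : ContinuousOn g {P | P.pt ∈ V})
    (hfg : ∀ (P : ComplexPoints X), P.pt ∈ V → P.pt ∈ X.left.basicOpen s → f P = g P)
    (P : ComplexPoints X) (hP : P.pt ∈ V) : f P = g P := by
  let W : X.left.Opens := X.left.basicOpen s
  have hWV : W ≤ V := X.left.basicOpen_le s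
  have hWne : ((W : Set X.left)).Nonempty := by
    rw [Set.nonempty_iff_ne_empty, Ne, TopologicalSpace.Opens.coe_eq_empty]
    intro hbot
    exact hs ((AlgebraicGeometry.basicOpen_eq_bot_iff s).mp hbot)
  have hWd : Dense (W : Set X.left) := W.isOpen.dense hWne
  have hdense : Dense {P : ComplexPoints X | P.pt ∈ W} :=
    ComplexPoints.dense_setOf_pt_mem (X := X) (ComplexPoints.closure_setOf_pt_mem_holds (X := X))
      W hWd
  have hdense' : Dense (Subtype.val ⁻¹' {P : ComplexPoints X | P.pt ∈ W} :
      Set ↥{P : ComplexPoints X | P.pt ∈ V}) :=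
    hdense.preimage (isOpen_setOf_pt_mem V).isOpenEmbedding_subtypeVal.isOpenMap
  have heq := Continuous.ext_on hdense' hf.restrict hg.restrict fun Q hQ ↦ hfg Q.1 Q.2 hQ
  exact congrFun heq ⟨P, hP⟩

end Density

/-! ### Points of codimension `≤ 1` -/

section CodimOne

variable {X : SchemeOver ℂ} [LocallyOfFiniteType X.hom] [IsIntegral X.left]

omit [LocallyOfFiniteType X.hom] in
/-- For `y ∈ V` affine and `a ∈ Γ(X, V)`: `a ∉ 𝔭_y ↔ y ∈ D(a)`. [folklore] -/
theorem notMem_primeIdealOf_iff {V : X.left.Opens} (hV : IsAffineOpen V) (y : V)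
    (a : Γ(X.left, V)) : a ∉ (hV.primeIdealOf y).asIdeal ↔ (y : X.left) ∈ X.left.basicOpen a := by
  haveI : Nonempty V := ⟨y⟩
  rw [← isUnitAt_algebraMap_iff hV y a, ← toFunctionField_algebraMap_stalk y a,
    algebraMap_stalk_eq_germ, isUnitAt_germ_iff]

/-- **Codimension `≤ 1`.** Let `y ∈ V` (affine) be a point whose local ring is regular of dimension
`≤ 1`, `a, b ∈ Γ(X, V)` with `a ≠ 0`, and `g` continuous on `V(ℂ)` with `g a = b` there. Then
`b / a ∈ 𝒪_{X,y}`. For otherwise, `𝒪_{X,y}` being a discrete valuation ring, `a / b ∈ 𝔪_y`: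
`a / b = a'/b'` with `a' ∈ 𝔭_y ∌ b'`; then `g a' = b'` on `D(a)(ℂ)`, hence on `V(ℂ)`
(`eqOn_of_eqOn_basicOpen`), which fails at any complex point of `\overline{{y}} ∩ V ∩ D(b')`
(`ComplexPoints.exists_pt_mem`), where `a'` vanishes and `b'` does not.
[cite: GortzWedhorn2020, Thm. 6.45 (p. 203)] -/
theorem isRegularAt_of_continuous_of_ringKrullDim_le_one {V : X.left.Opens} (hV : IsAffineOpen V)
    [Nonempty V] (y : V) (hreg : IsRegularLocalRing (X.left.presheaf.stalk (y : X.left)))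
    (hdim : ringKrullDim (X.left.presheaf.stalk (y : X.left)) ≤ 1)
    {a b : Γ(X.left, V)} (ha : a ≠ 0) {g : ComplexPoints X → ℂ}
    (hg : ContinuousOn g {P | P.pt ∈ V})
    (hgab : ∀ (P : ComplexPoints X) (hP : P.pt ∈ V), g P * P.eval V hP a = P.eval V hP b) :
    IsRegularAt (y : X.left)
      (algebraMap Γ(X.left, V) X.left.functionField b / algebraMap Γ(X.left, V) X.left.functionField a) := by
  haveI := hreg
  by_cases hb : b = 0
  · rw [hb, map_zero, zero_div]
    exact isRegularAt_zero
  have hbK : algebraMap Γ(X.left, V) X.left.functionField b ≠ 0 := algebraMap_ne_zero_iff.mpr hb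
  set h := algebraMap Γ(X.left, V) X.left.functionField b /
    algebraMap Γ(X.left, V) X.left.functionField a with hh
  haveI := Literature.AlgebraicGeometry.Resolution.isDomain_of_isRegularLocalRing
    (X.left.presheaf.stalk (y : X.left))
  haveI := valuationRing_of_isRegularLocalRing_of_ringKrullDim_le_one
    (X.left.presheaf.stalk (y : X.left)) hdim
  rcases ValuationRing.isInteger_or_isInteger (X.left.presheaf.stalk (y : X.left)) h with hint | hint
  · exact (isRegularAt_iff_isInteger _ h).mpr hint
  have hinv : IsRegularAt (y : X.left) h⁻¹ := (isRegularAt_iff_isInteger _ h⁻¹).mpr hint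
  by_cases hu : IsUnitAt (y : X.left) h⁻¹
  · simpa using hu.inv.isRegularAt
  exfalso
  obtain ⟨a', b', hb', e⟩ := (isRegularAt_iff_exists hV y h⁻¹).1 hinv
  -- `a' ∈ 𝔭_y`
  have ha' : a' ∈ (hV.primeIdealOf y).asIdeal := by
    by_contra ha'
    apply hu
    have h1 : h⁻¹ = algebraMap Γ(X.left, V) X.left.functionField a' /
        algebraMap Γ(X.left, V) X.left.functionField b' := by
      rw [eq_div_iff (algebraMap_ne_zero_of_notMem hV hb'), e]
    rw [h1]
    exact ((isUnitAt_algebraMap_iff hV y a').2 ha').div ((isUnitAt_algebraMap_iff hV y b').2 hb')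
  -- `a b' = a' b` in `Γ(X, V)`
  have hrel : a * b' = a' * b := by
    apply algebraMap_injective (V := V)
    rw [map_mul, map_mul, ← e, hh, inv_div, div_mul_eq_mul_div, div_mul_cancel₀ _ hbK]
  -- `g a' = b'` on `V(ℂ)`
  have hga' : ∀ (P : ComplexPoints X) (hP : P.pt ∈ V), g P * P.eval V hP a' = P.eval V hP b' := by
    have key := eqOn_of_eqOn_basicOpen (X := X) ha
      (f := fun P ↦ g P * evalOrZero V a' P) (g := evalOrZero V b')
      (hg.mul (continuousOn_evalOrZero V a')) (continuousOn_evalOrZero V b') (by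
        intro P hP hPa
        show g P * evalOrZero V a' P = evalOrZero V b' P
        rw [evalOrZero_of_mem a' hP, evalOrZero_of_mem b' hP]
        have h1 : P.eval V hP a ≠ 0 := (pt_mem_basicOpen_iff P hP a).mp hPa
        have h2 : P.eval V hP a * P.eval V hP b' = P.eval V hP a' * P.eval V hP b := by
          simpa only [map_mul, evalRingHom_apply] using congrArg (P.evalRingHom V hP) hrel
        rw [← hgab P hP] at h2
        -- `a b' = a' (g a)`, cancel `a(P)`
        apply mul_left_cancel₀ h1
        calc P.eval V hP a * (g P * P.eval V hP a')
            = P.eval V hP a' * (g P * P.eval V hP a) := by ring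
          _ = P.eval V hP a * P.eval V hP b' := h2.symm)
    intro P hP
    have h1 : g P * evalOrZero V a' P = evalOrZero V b' P := key P hP
    rwa [evalOrZero_of_mem a' hP, evalOrZero_of_mem b' hP] at h1
  -- a complex point of `cl{y} ∩ V ∩ D(b')`
  have hyb' : (y : X.left) ∈ X.left.basicOpen b' := (notMem_primeIdealOf_iff hV y b').mp hb'
  let Z : Set X.left := closure {(y : X.left)} ∩ ((V : Set X.left) ∩ (X.left.basicOpen b' : Set X.left))
  have hZne : Z.Nonempty := ⟨y, subset_closure rfl, y.2, hyb'⟩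
  have hZlc : IsLocallyClosed Z :=
    isClosed_closure.isLocallyClosed.inter (V.isOpen.inter (X.left.basicOpen b').isOpen).isLocallyClosed
  obtain ⟨P, hPZ⟩ := ComplexPoints.exists_pt_mem hZne hZlc
  have hPV : P.pt ∈ V := hPZ.2.1
  have hPb' : P.eval V hPV b' ≠ 0 := (pt_mem_basicOpen_iff P hPV b').mp hPZ.2.2
  have hPa' : P.eval V hPV a' = 0 := by
    by_contra hne
    have h1 : P.pt ∈ X.left.basicOpen a' := (pt_mem_basicOpen_iff P hPV a').mpr hne
    have hsp : (y : X.left) ⤳ P.pt := specializes_iff_mem_closure.mpr hPZ.1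
    have h2 : (y : X.left) ∈ X.left.basicOpen a' := hsp.mem_open (X.left.basicOpen a').isOpen h1
    exact (notMem_primeIdealOf_iff hV y a').mpr h2 ha'
  have h3 := hga' P hPV
  rw [hPa', mul_zero] at h3
  exact hPb' h3.symm

end CodimOne

/-! ### All points: algebraic Hartogs -/

section AllPoints

variable {X : SchemeOver ℂ} [LocallyOfFiniteType X.hom] [IsIntegral X.left]

/-- **All points.** With `X`, `V`, `a`, `b`, `g` as in
`isRegularAt_of_continuous_of_ringKrullDim_le_one` and ALL local rings of `X` regular, `b / a` is
regular at every point `y ∈ V`: `𝒪_{X,y}` is factorial (Auslander–Buchsbaum, Matsumura Thm. 20.3),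
hence the intersection of its localisations at prime elements `ϖ`
(`exists_algebraMap_eq_of_forall_prime`), and `(𝒪_{X,y})_{(ϖ)}` is the local ring of the
codimension-one generization `y_ϖ ∈ V` of `y` — verbatim the tree's
`RatFn.isRegularAt_of_forall_isRegularAt_comap_affine` with the codimension-one step replaced.
[cite: GortzWedhorn2020, Prop. B.73 (3) (p. 571)] [cite: Matsumura1987, Thm. 20.3] -/
theorem isRegularAt_of_continuous {V : X.left.Opens} (hV : IsAffineOpen V) [Nonempty V]
    (hreg : ∀ x : X.left, IsRegularLocalRing (X.left.presheaf.stalk x))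
    {a b : Γ(X.left, V)} (ha : a ≠ 0) {g : ComplexPoints X → ℂ}
    (hg : ContinuousOn g {P | P.pt ∈ V})
    (hgab : ∀ (P : ComplexPoints X) (hP : P.pt ∈ V), g P * P.eval V hP a = P.eval V hP b) (y : V) :
    IsRegularAt (y : X.left)
      (algebraMap Γ(X.left, V) X.left.functionField b / algebraMap Γ(X.left, V) X.left.functionField a) := by
  classical
  set h := algebraMap Γ(X.left, V) X.left.functionField b /
    algebraMap Γ(X.left, V) X.left.functionField a
  haveI : IsRegularLocalRing (X.left.presheaf.stalk (y : X.left)) := hreg y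
  haveI := Literature.AlgebraicGeometry.Resolution.isDomain_of_isRegularLocalRing
    (X.left.presheaf.stalk (y : X.left))
  haveI : UniqueFactorizationMonoid (X.left.presheaf.stalk (y : X.left)) :=
    Literature.AlgebraicGeometry.Resolution.IsRegularLocalRing.uniqueFactorizationMonoid _
  haveI := hV.isLocalization_stalk y
  -- Hartogs for the factorial ring `𝒪_{X,y}`
  suffices hx : ∀ ϖ : X.left.presheaf.stalk (y : X.left), Prime ϖ →
      ∃ d e : X.left.presheaf.stalk (y : X.left),
        ¬ ϖ ∣ e ∧ h * toFunctionField (y : X.left) e = toFunctionField (y : X.left) d by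
    obtain ⟨r, hr⟩ := exists_algebraMap_eq_of_forall_prime
      (R := X.left.presheaf.stalk (y : X.left)) h hx
    exact ⟨r, hr⟩
  intro ϖ hϖ
  -- the height-one prime `(ϖ)` and its trace `p` on `Γ(X, V)`; the point `y' = y_ϖ`
  haveI hϖp : (span {ϖ} : Ideal (X.left.presheaf.stalk (y : X.left))).IsPrime :=
    (span_singleton_prime hϖ.ne_zero).2 hϖ
  have hϖ1 : (span {ϖ} : Ideal (X.left.presheaf.stalk (y : X.left))).height ≤ 1 :=
    height_le_one_of_isPrincipal_of_mem_minimalPrimes (span {ϖ}) (span {ϖ})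
      (by rw [Ideal.minimalPrimes_eq_subsingleton_self]; exact Set.mem_singleton _)
  set p : Ideal Γ(X.left, V) :=
    (span {ϖ} : Ideal (X.left.presheaf.stalk (y : X.left))).under Γ(X.left, V) with hp
  haveI hpp : p.IsPrime := IsPrime.under _ _
  obtain ⟨y', hpy'⟩ : ∃ y' : V, hV.primeIdealOf y' = ⟨p, hpp⟩ :=
    ⟨⟨hV.fromSpec ⟨p, hpp⟩, hV.range_fromSpec.le ⟨_, rfl⟩⟩, by
      apply hV.fromSpec.isOpenEmbedding.injective
      rw [hV.fromSpec_primeIdealOf]⟩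
  -- `𝒪_{X,y'}` has dimension `= ht p = ht (ϖ) ≤ 1`
  haveI := hV.isLocalization_stalk y'
  have hdim : ringKrullDim (X.left.presheaf.stalk (y' : X.left)) ≤ 1 := by
    rw [IsLocalization.AtPrime.ringKrullDim_eq_height (hV.primeIdealOf y').asIdeal
      (X.left.presheaf.stalk (y' : X.left)), hpy']
    change ((p.height : ℕ∞) : WithBot ℕ∞) ≤ 1
    rw [hp, IsLocalization.height_under (hV.primeIdealOf y).asIdeal.primeCompl
      (span {ϖ} : Ideal (X.left.presheaf.stalk (y : X.left)))]
    exact_mod_cast hϖ1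
  -- so `h` is regular at `y'`
  have hreg' : IsRegularAt (y' : X.left) h :=
    isRegularAt_of_continuous_of_ringKrullDim_le_one hV y' (hreg _) hdim ha hg hgab
  -- read off a denominator not divisible by `ϖ`
  obtain ⟨a₁, b₁, hb₁, e⟩ := (isRegularAt_iff_exists hV y' h).1 hreg'
  rw [hpy'] at hb₁
  refine ⟨algebraMap Γ(X.left, V) _ a₁, algebraMap Γ(X.left, V) _ b₁, fun hdvd => hb₁ ?_, ?_⟩
  · exact mem_comap.2 (mem_span_singleton.2 hdvd)
  · rw [toFunctionField_algebraMap_stalk, toFunctionField_algebraMap_stalk, e]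

end AllPoints

/-! ### The theorem: a continuous rational function is regular -/

section Main

variable {X : SchemeOver ℂ} [LocallyOfFiniteType X.hom] [IsIntegral X.left]

/-- **A continuous rational function on a variety with regular local rings is regular.** `X`
integral, locally of finite type over `ℂ`, all local rings regular (e.g. `X` smooth over `ℂ`);
`V ⊆ X` affine open; `a, b ∈ Γ(X, V)`, `a ≠ 0`; `g` continuous on `V(ℂ)` with `g(P) a(P) = b(P)`
for all `P ∈ V(ℂ)`. Then there is `c ∈ Γ(X, V)` with `c(P) = g(P)` for all `P ∈ V(ℂ)`: the
rational function `b / a` is regular at every point of `V` (`isRegularAt_of_continuous`), hence a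
section `c` over `V` (`RatFn.exists_germ_eq_of_forall_isRegularAt`), and `c = g` on `D(a)(ℂ)`,
hence on `V(ℂ)` (`eqOn_of_eqOn_basicOpen`). [cite: GortzWedhorn2020, Thm. 6.45 (p. 203)]
[cite: SGA1, Exp. XII Prop. 2.2] -/
theorem exists_eval_eq_of_continuous_rational
    (hreg : ∀ x : X.left, IsRegularLocalRing (X.left.presheaf.stalk x))
    {V : X.left.Opens} (hV : IsAffineOpen V) {a b : Γ(X.left, V)} (ha : a ≠ 0)
    {g : ComplexPoints X → ℂ} (hg : ContinuousOn g {P | P.pt ∈ V})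
    (hgab : ∀ (P : ComplexPoints X) (hP : P.pt ∈ V), g P * P.eval V hP a = P.eval V hP b) :
    ∃ c : Γ(X.left, V), ∀ (P : ComplexPoints X) (hP : P.pt ∈ V), P.eval V hP c = g P := by
  by_cases hVne : ((V : Set X.left)).Nonempty
  swap
  · refine ⟨0, fun P hP ↦ (hVne ⟨P.pt, hP⟩).elim⟩
  obtain ⟨y₀, hy₀⟩ := hVne
  haveI : Nonempty V := ⟨⟨y₀, hy₀⟩⟩
  have haK : algebraMap Γ(X.left, V) X.left.functionField a ≠ 0 := algebraMap_ne_zero_iff.mpr ha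
  set h := algebraMap Γ(X.left, V) X.left.functionField b /
    algebraMap Γ(X.left, V) X.left.functionField a with hh
  have hξ : genericPoint X.left ∈ V :=
    ((genericPoint_spec X.left).mem_open_set_iff V.isOpen).mpr ⟨y₀, Set.mem_univ _, hy₀⟩
  obtain ⟨c, hc⟩ := RatFn.exists_germ_eq_of_forall_isRegularAt (X := X.left) (U := V) hξ
    (h := h) fun y hy ↦ isRegularAt_of_continuous hV hreg ha hg hgab ⟨y, hy⟩
  have hc' : algebraMap Γ(X.left, V) X.left.functionField c = h := hc
  -- `c a = b`
  have hcab : c * a = b := by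
    apply algebraMap_injective (V := V)
    rw [map_mul, hc', hh, div_mul_cancel₀ _ haK]
  refine ⟨c, fun P hP ↦ ?_⟩
  have key := eqOn_of_eqOn_basicOpen (X := X) ha (f := evalOrZero V c) (g := g)
    (continuousOn_evalOrZero V c) hg (fun Q hQ hQa ↦ by
      show evalOrZero V c Q = g Q
      rw [evalOrZero_of_mem c hQ]
      have h1 : Q.eval V hQ a ≠ 0 := (pt_mem_basicOpen_iff Q hQ a).mp hQa
      apply mul_right_cancel₀ h1
      rw [hgab Q hQ, ← evalRingHom_apply, ← evalRingHom_apply, ← map_mul, hcab, evalRingHom_apply])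
    P hP
  have key' : evalOrZero V c P = g P := key
  rwa [evalOrZero_of_mem c hP] at key'

end Main

/-! ### Theorem B′: the characteristic polynomial of a continuous ALGEBRAIC function -/

section Algebra

/-- **From coefficients to the polynomial** (a variant of
`CharPolyIntegral.exists_monic_map_eq_prod` indexed by multisets): if `A → (ι → ℂ)`, `x ↦ (φᵢ x)ᵢ`,
is injective, the multisets `Mᵢ` all have cardinality `d`, and `b_j ∈ A` satisfies
`φᵢ(b_j) = coeff_j ∏_{z ∈ Mᵢ} (τ - z)` for all `i`, `j`, then `Q = Σ_{j ≤ d} b_j τ^j` is monic with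
`Q(φᵢ) = ∏_{z ∈ Mᵢ} (τ - z)` for all `i`. [folklore] -/
theorem exists_monic_map_eq_prod {A : Type*} [CommRing A] {ι : Type*} (φ : ι → A →+* ℂ)
    (hφ : Function.Injective (RingHom.pi φ)) (M : ι → Multiset ℂ) (d : ℕ)
    (hM : ∀ i, Multiset.card (M i) = d) (b : ℕ → A)
    (hb : ∀ j i, φ i (b j) = (((M i).map fun z ↦ X - C z).prod).coeff j) :
    ∃ Q : A[X], Q.Monic ∧ ∀ i, Q.map (φ i) = ((M i).map fun z ↦ X - C z).prod := by
  classical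
  let Q : A[X] := ∑ j ∈ Finset.range (d + 1), monomial j (b j)
  have hQc : ∀ n, Q.coeff n = if n ∈ Finset.range (d + 1) then b n else 0 := by
    intro n
    simp only [Q, finsetSum_coeff, coeff_monomial]
    rw [Finset.sum_ite_eq']
  have hχm : ∀ i, (((M i).map fun z ↦ X - C z).prod).Monic := fun i ↦
    monic_multiset_prod_of_monic _ _ fun z _ ↦ monic_X_sub_C z
  have hχd : ∀ i, (((M i).map fun z ↦ X - C z).prod).natDegree = d := fun i ↦ by
    rw [natDegree_multiset_prod_X_sub_C_eq_card, hM]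
  have hQmap : ∀ i, Q.map (φ i) = ((M i).map fun z ↦ X - C z).prod := by
    intro i
    ext n : 1
    rw [coeff_map, hQc]
    split_ifs with hn
    · exact hb n i
    · rw [map_zero]
      rw [Finset.mem_range, not_lt] at hn
      exact (coeff_eq_zero_of_natDegree_lt (by rw [hχd]; omega)).symm
  have hbd : b d = 1 := hφ (funext fun i ↦ by
    change φ i (b d) = φ i 1
    rw [hb, map_one]
    have h1 := (hχm i).coeff_natDegree
    rwa [hχd i] at h1)
  have hQnat : Q.natDegree ≤ d :=
    natDegree_sum_le_of_forall_le _ _ fun j hj ↦ (natDegree_monomial_le _).trans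
      (by rw [Finset.mem_range] at hj; omega)
  have hQd : Q.coeff d = 1 := by
    rw [hQc, if_pos (Finset.self_mem_range_succ d), hbd]
  exact ⟨Q, monic_of_natDegree_le_of_coeff_eq_one d hQnat hQd, hQmap⟩

/-- **Coefficients of `∏ (τ - a z)` versus `∏ (τ - z)`**: scaling the roots by `a` multiplies the
`j`-th coefficient by `a^{d-j}` (`d` the number of roots; Mathlib `Multiset.prod_X_sub_C_coeff`,
`Multiset.pow_smul_esymm`). [folklore] -/
theorem coeff_prod_X_sub_C_map_mul {R : Type*} [CommRing R] (M : Multiset R) (a : R) {j : ℕ}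
    (hj : j ≤ Multiset.card M) :
    ((M.map fun z ↦ a * z).map fun z ↦ X - C z).prod.coeff j =
      a ^ (Multiset.card M - j) * (M.map fun z ↦ X - C z).prod.coeff j := by
  have hc : Multiset.card (M.map fun z ↦ a * z) = Multiset.card M := Multiset.card_map _ _
  rw [Multiset.prod_X_sub_C_coeff _ (by rw [hc]; exact hj), Multiset.prod_X_sub_C_coeff _ hj, hc]
  have h1 : (M.map fun z ↦ a * z) = M.map (a • ·) := rfl
  rw [h1, ← Multiset.pow_smul_esymm, smul_eq_mul]
  ring

end Algebra

section CharPoly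

variable {X : SchemeOver ℂ} [IsSeparated X.hom] [LocallyOfFiniteType X.hom] [IsIntegral X.left]

open Literature.AlgebraicGeometry.Resolution in
/-- **Theorem B′: the characteristic polynomial of a continuous algebraic function along a finite
covering is regular.** `X` integral, separated and locally of finite type over `ℂ` with regular
local rings; `U ⊆ X` affine open; `q : T → X(ℂ)` a covering map with finite fibres; `h : T → ℂ`
continuous on `q⁻¹(U(ℂ))` with `F(q t)(h t) = 0` there for one NON-ZERO `F ∈ Γ(X, U)[τ]`. Then
there is a monic `Q ∈ Γ(X, U)[τ]` with `roots Q(P) = {h t | t ∈ q⁻¹(P)}` for all `P ∈ U(ℂ)`.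
Proof: with `a = lead(F) ≠ 0`, the function `a h` is continuous and integral (Mathlib
`Polynomial.integralNormalization`), so Theorem B (`CharPolyIntegral.exists_charPoly`; `Γ(X, U)` is
integrally closed as the local rings are regular) gives its characteristic polynomial `Q₁`; the
`j`-th coefficient `c_j` of `χ_h` is continuous (`CharPolyIntegral.continuousOn_coeff_charPoly`)
with `c_j a^{d-j} = coeff_j(Q₁)` on `U(ℂ)` (`coeff_prod_X_sub_C_map_mul`), hence regular
(`exists_eval_eq_of_continuous_rational`), and `Q = Σ c_j τ^j` (`exists_monic_map_eq_prod`).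
[cite: SGA1, Exp. XII Thm. 5.1 (p. 333), proof, part 2] [cite: Forster1981, §8 (model)] -/
theorem exists_charPoly_of_algebraic
    (hreg : ∀ x : X.left, IsRegularLocalRing (X.left.presheaf.stalk x))
    {U : X.left.Opens} (hU : IsAffineOpen U) {T : Type*} [TopologicalSpace T]
    {q : T → ComplexPoints X} (hq : IsCoveringMap q) (hfin : ∀ P, (q ⁻¹' {P}).Finite)
    (h : T → ℂ) (hh : ContinuousOn h (q ⁻¹' {P | P.pt ∈ U})) (F : Γ(X.left, U)[X]) (hF : F ≠ 0)
    (hroot : ∀ (t : T) (ht : (q t).pt ∈ U), (F.map ((q t).evalRingHom U ht)).eval (h t) = 0) :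
    ∃ Q : Γ(X.left, U)[X], Q.Monic ∧ ∀ (P : ComplexPoints X) (hP : P.pt ∈ U),
      (Q.map (P.evalRingHom U hP)).roots = ((hfin P).toFinset.val).map h := by
  classical
  -- the index set `ι = U(ℂ)` and the evaluation maps
  let ι := ↥{P : ComplexPoints X | P.pt ∈ U}
  let φ : ι → Γ(X.left, U) →+* ℂ := fun i ↦ i.1.evalRingHom U i.2
  have hφ : Function.Injective (RingHom.pi φ) := by
    refine (injective_iff_map_eq_zero _).mpr fun x hx ↦ ?_
    exact CharPolyRegular.eq_zero_of_forall_eval_eq_zero x fun P hP ↦ congrFun hx ⟨P, hP⟩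
  rcases isEmpty_or_nonempty ι with hι | ⟨⟨P₀⟩⟩
  · exact ⟨1, monic_one, fun P hP ↦ (hι.false ⟨P, hP⟩).elim⟩
  haveI : Nonempty U := ⟨⟨P₀.1.pt, P₀.2⟩⟩
  have hUne : (U : Set X.left).Nonempty := ⟨P₀.1.pt, P₀.2⟩
  have hA : IsIntegrallyClosed Γ(X.left, U) :=
    isIntegrallyClosed_sections_of_stalk (Y := X.left)
      (fun y ↦ haveI := hreg y; isIntegrallyClosed_of_isRegularLocalRing _) ⟨U, hU⟩
  -- fibre cardinality `d`
  haveI : PreconnectedSpace X.left := inferInstance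
  set d := (hfin P₀.1).toFinset.card with hd
  have hcard : ∀ P : ComplexPoints X, (hfin P).toFinset.card = d :=
    fun P ↦ CharPolyIntegral.card_fibre_eq hq hfin P P₀.1
  let M : ComplexPoints X → Multiset ℂ := fun P ↦ ((hfin P).toFinset.val).map h
  have hMcard : ∀ P, Multiset.card (M P) = d := fun P ↦ by
    rw [Multiset.card_map, Finset.card_val, hcard]
  by_cases hd0 : d = 0
  · refine ⟨1, monic_one, fun P hP ↦ ?_⟩
    have h1 : (hfin P).toFinset = ∅ := Finset.card_eq_zero.mp (by rw [hcard, hd0])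
    rw [Polynomial.map_one, roots_one, h1]
    rfl
  -- the leading coefficient `a`, and `deg F ≥ 1`
  set a := F.leadingCoeff with hadef
  have ha : a ≠ 0 := leadingCoeff_ne_zero.mpr hF
  have hF1 : 1 ≤ F.natDegree := by
    by_contra hlt
    have h0 : F.natDegree = 0 := by omega
    have hFC : F = C a := by rw [eq_C_of_natDegree_eq_zero h0, hadef, Polynomial.leadingCoeff, h0]
    -- a complex point of `D(a)`, and a point of `T` over it
    have hne : ((X.left.basicOpen a : X.left.Opens) : Set X.left).Nonempty := by
      rw [Set.nonempty_iff_ne_empty, Ne, TopologicalSpace.Opens.coe_eq_empty]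
      exact fun hbot ↦ ha ((AlgebraicGeometry.basicOpen_eq_bot_iff a).mp hbot)
    obtain ⟨P, hPa⟩ := ComplexPoints.exists_pt_mem hne (X.left.basicOpen a).isOpen.isLocallyClosed
    have hPU : P.pt ∈ U := X.left.basicOpen_le a hPa
    have hfib : (hfin P).toFinset.Nonempty := by
      rw [← Finset.card_pos, hcard]; omega
    obtain ⟨t, ht⟩ := hfib
    have hqt : q t = P := (Set.Finite.mem_toFinset (hfin P)).mp ht
    have h2 : ∀ (P' : ComplexPoints X) (_ : q t = P') (hP' : P'.pt ∈ U),
        P'.eval U hP' a = 0 := by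
      rintro _ rfl hP'
      have h3 := hroot t hP'
      rwa [hFC, map_C, eval_C, evalRingHom_apply] at h3
    exact (pt_mem_basicOpen_iff P hPU a).mp hPa (h2 P hqt hPU)
  -- `a h` is continuous and integral: Theorem B
  let h₁ : T → ℂ := fun t ↦ evalOrZero U a (q t) * h t
  have hh₁ : ContinuousOn h₁ (q ⁻¹' {P | P.pt ∈ U}) :=
    ((continuousOn_evalOrZero U a).comp hq.continuous.continuousOn fun t ht ↦ ht).mul hh
  have hroot₁ : ∀ (t : T) (ht : (q t).pt ∈ U),
      ((integralNormalization F).map ((q t).evalRingHom U ht)).eval (h₁ t) = 0 := by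
    intro t ht
    change ((integralNormalization F).map ((q t).evalRingHom U ht)).eval
      (evalOrZero U a (q t) * h t) = 0
    rw [evalOrZero_of_mem a ht, ← evalRingHom_apply, Polynomial.eval_map, hadef,
      integralNormalization_eval₂_leadingCoeff_mul hF1, ← Polynomial.eval_map, hroot t ht, mul_zero]
  obtain ⟨Q₁, hQ₁, hQ₁r⟩ := CharPolyIntegral.exists_charPoly hU hUne hA hq hfin h₁ hh₁
    (integralNormalization F) (monic_integralNormalization hF) hroot₁
  -- `M₁(P) = a(P) M(P)` and `Q₁(P) = ∏_{z ∈ M₁(P)} (τ - z)`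
  have hM₁ : ∀ (P : ComplexPoints X) (hP : P.pt ∈ U),
      ((hfin P).toFinset.val).map h₁ = (M P).map fun z ↦ P.eval U hP a * z := by
    intro P hP
    change _ = (((hfin P).toFinset.val).map h).map _
    rw [Multiset.map_map]
    refine Multiset.map_congr rfl fun t ht ↦ ?_
    have hqt : q t = P := (Set.Finite.mem_toFinset (hfin P)).mp (Finset.mem_val.mp ht)
    change evalOrZero U a (q t) * h t = P.eval U hP a * h t
    rw [hqt, evalOrZero_of_mem a hP]
  have hQ₁P : ∀ (P : ComplexPoints X) (hP : P.pt ∈ U), Q₁.map (P.evalRingHom U hP) =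
      (((M P).map fun z ↦ P.eval U hP a * z).map fun z ↦ Polynomial.X - C z).prod := by
    intro P hP
    have hm : (Q₁.map (P.evalRingHom U hP)).Monic := hQ₁.map _
    have hc : Multiset.card (Q₁.map (P.evalRingHom U hP)).roots =
        (Q₁.map (P.evalRingHom U hP)).natDegree :=
      ((IsAlgClosed.splits (Q₁.map (P.evalRingHom U hP))).natDegree_eq_card_roots).symm
    rw [← prod_multiset_X_sub_C_of_monic_of_roots_card_eq hm hc, hQ₁r P hP, hM₁ P hP]
  -- the coefficients of `χ_h` are continuous rational functions, hence regular
  let c : ℕ → ComplexPoints X → ℂ := fun j P ↦ ((M P).map fun z ↦ Polynomial.X - C z).prod.coeff j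
  have hrel : ∀ j, j ≤ d → ∀ (P : ComplexPoints X) (hP : P.pt ∈ U),
      c j P * P.eval U hP (a ^ (d - j)) = P.eval U hP (Q₁.coeff j) := by
    intro j hj P hP
    have h1 : P.eval U hP (Q₁.coeff j) = (Q₁.map (P.evalRingHom U hP)).coeff j := by
      rw [coeff_map, evalRingHom_apply]
    rw [h1, hQ₁P P hP, coeff_prod_X_sub_C_map_mul (M P) (P.eval U hP a) (by rw [hMcard]; exact hj),
      hMcard,
      ← evalRingHom_apply, map_pow, evalRingHom_apply, mul_comm]
  have key : ∀ j, ∃ c' : Γ(X.left, U), ∀ (P : ComplexPoints X) (hP : P.pt ∈ U),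
      P.eval U hP c' = c j P := by
    intro j
    by_cases hj : j ≤ d
    · haveI : IsDomain Γ(X.left, U) := inferInstance
      exact exists_eval_eq_of_continuous_rational hreg hU (pow_ne_zero _ ha) (g := c j)
        (CharPolyIntegral.continuousOn_coeff_charPoly hq hfin h hh j) (hrel j hj)
    · refine ⟨0, fun P hP ↦ ?_⟩
      rw [← evalRingHom_apply, map_zero]
      have hdeg : ((M P).map fun z ↦ Polynomial.X - C z).prod.natDegree = d := by
        rw [natDegree_multiset_prod_X_sub_C_eq_card, hMcard]
      exact (coeff_eq_zero_of_natDegree_lt (by rw [hdeg]; omega)).symm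
  choose c' hc' using key
  obtain ⟨Q, hQm, hQ⟩ := exists_monic_map_eq_prod φ hφ (fun i ↦ M i.1) d (fun i ↦ hMcard i.1) c'
    fun j i ↦ (evalRingHom_apply i.1 U i.2 (c' j)).trans (hc' j i.1 i.2)
  refine ⟨Q, hQm, fun P hP ↦ ?_⟩
  have h1 := hQ ⟨P, hP⟩
  change Q.map (P.evalRingHom U hP) = ((M P).map fun z ↦ Polynomial.X - C z).prod at h1
  rw [h1, roots_multiset_prod_X_sub_C]

end CharPoly

end ContinuousRational

end Literature.AlgebraicGeometry.FundamentalGroup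

end
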